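import Summits.QuantumFields.YangMills.Theorems.ColdStartUniversalityShenZhuZhuW1DiracContractionSU2
import HarnessLib

/-!
# `W₁` GEOMETRIC ERGODICITY of the `SU(2)` lattice Langevin dynamics on `(ℤ/L)³`, `|β'| < 1/12`, VOLUME-UNIFORM RATE:
# `W₁^{ρ_L}(νP_t, μ_(β')) ≤ e^(−(1−12|β'|)t)·W₁^{ρ_L}(ν, μ_(β'))` and `W₁^{ρ_L}(δ_Q P_t, μ_(β')) ≤ e^(−(1−12|β'|)t)·∫ρ_L(Q,·)dμ_(β') ≤ e^(−(1−12|β'|)t)·√2·π·√#E`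

Seat `ym-line-csu-p1` (g41), route `ColdStartUniversality` of `Summits/QuantumFields/YangMills`, helper file G59 (`--supports stmt-QuantumFields-24809`).
Corollaries of G58 (`wilson_szzWasserstein_W1_contraction_of_initialLaws`, optimal couplings via the tree's Kantorovich–Rubinstein duality) and the
invariance of the Wilson–Gibbs law (`wilsonMeasureLangevinInvariant_su2`): convergence to equilibrium in the `W₁` (coupling) sense from every initial law
and every deterministic start, with the volume-uniform rate `1 − 12|β'|`.  `W₁` is the tree's `szzWassersteinSq` with the un-squared cost `ρ_L`.

* ★★★ `wilson_szzWasserstein_W1_convergence_of_initialLaw` — `W₁(κ_t ∘ₘ ν, μ_(β')) ≤ ofReal(e^(−(1−12|β'|)t))·W₁(ν, μ_(β'))`;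
* ★★ `szzWasserstein_W1_dirac_le` — `W₁(δ_Q, μ) ≤ ofReal(∫ρ_L(Q,·)dμ)` (product coupling);
* ★★★ `wilson_szzWasserstein_W1_convergence_dirac` — `W₁(κ_t(Q,·), μ_(β')) ≤ ofReal(e^(−(1−12|β'|)t)·∫ρ_L(Q,·)dμ_(β'))`;
* ★★ `wilson_szzWasserstein_W1_convergence_dirac_diam` — `… ≤ ofReal(e^(−(1−12|β'|)t)·√2·π·√#E)`.

THEOREMS ONLY, no definition, no sorry.  HONEST FRAMING: `W₁`, not the printed `W₂`; fixed cut-off, `|β'| < 1/12`; the prefactor for a cold start is the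
mean distance `∫ρ_L(Q,·)dμ = O(√#E)` (as it must be); nothing `K`-uniform along the route's scaling; `UniformColdStartMixing` (24809, ASIDE) not restated;
no crux, rung or summit statement is proved; the Yang–Mills mass gap is NOT proved.
-/

set_option autoImplicit false

noncomputable section

namespace Summit.QuantumFields.YangMills.Theorems.ColdStartUniversality

open MeasureTheory ProbabilityTheory Matrix Complex Finset Filter Topology Set
open scoped BigOperators NNReal ENNReal
open Literature.MathematicalPhysics.QuantumFieldTheory
open Literature.MathematicalPhysics.QuantumLattice (fundamentalRep fundamentalLatticeRep continuous_fundamentalRep fundamentalRep_apply fundamentalLatticeRep_N)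

variable {L : ℕ} [NeZero L]

/-- ★★★ **`W₁(νP_t, μ_(β')) ≤ e^(−(1−12|β'|)t)·W₁(ν, μ_(β'))`** for every initial law `ν` (invariance `μ_(β')P_t = μ_(β')` + G58).
[cite: ShenZhuZhu2022, Theorem 4.2 (4.5)] -/
theorem wilson_szzWasserstein_W1_convergence_of_initialLaw (L : ℕ) [NeZero L]
    (ν : Measure (GaugeConfig 3 L (Matrix.specialUnitaryGroup (Fin 2) ℂ))) [IsProbabilityMeasure ν] (t : ℝ≥0) (β' : ℝ) (hβ : |β'| < 1 / 12)
    (κ : ℝ≥0 → Kernel (GaugeConfig 3 L (Matrix.specialUnitaryGroup (Fin 2) ℂ))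
      (GaugeConfig 3 L (Matrix.specialUnitaryGroup (Fin 2) ℂ))) [∀ t, IsMarkovKernel (κ t)]
    (hreal : ∀ (t : ℝ≥0) (x : GaugeConfig 3 L (Matrix.specialUnitaryGroup (Fin 2) ℂ))
        (Ω : Type) [MeasurableSpace Ω] (P : Measure Ω) [IsProbabilityMeasure P]
        (W : ℝ≥0 → Ω → (Edge 3 L × NoiseIdx 2 → ℝ)) (hW : IsFlatBrownian W P)
        (U : ℝ≥0 → Ω → GaugeConfig 3 L (Matrix.specialUnitaryGroup (Fin 2) ℂ)),
        (∀ ω, U 0 ω = x) →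
        (latticeLangevinDynamics (fundamentalLatticeRep 2) β').IsSolution (fundamentalRep (Fin 2))
          hW.natFiltration P W U →
        κ t x = P.map (U t))
    :
    szzWassersteinSq (fun U U' : GaugeConfig 3 L (Matrix.specialUnitaryGroup (Fin 2) ℂ) => Real.sqrt (torusRiemannDistSq (fundamentalLatticeRep 2) U U')) (κ t ∘ₘ ν) (wilsonMeasure (d := 3) (L := L) (fundamentalRep (Fin 2)) β') ≤
      ENNReal.ofReal (Real.exp (-((1 - 12 * |β'|) * (t : ℝ)))) * szzWassersteinSq (fun U U' : GaugeConfig 3 L (Matrix.specialUnitaryGroup (Fin 2) ℂ) => Real.sqrt (torusRiemannDistSq (fundamentalLatticeRep 2) U U')) ν (wilsonMeasure (d := 3) (L := L) (fundamentalRep (Fin 2)) β') := by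
  haveI : IsProbabilityMeasure (wilsonMeasure (d := 3) (L := L) (fundamentalRep (Fin 2)) β') :=
    isProbabilityMeasure_wilsonMeasure (d := 3) (L := L) (fundamentalRep (Fin 2)) (continuous_fundamentalRep (Fin 2)) β'
  have hinv : (wilsonMeasure (d := 3) (L := L) (fundamentalRep (Fin 2)) β').bind (κ t) = (wilsonMeasure (d := 3) (L := L) (fundamentalRep (Fin 2)) β') := (wilson_invariant_of_fact L β' (wilsonMeasureLangevinInvariant_su2 L β') κ hreal t).def
  have h := wilson_szzWasserstein_W1_contraction_of_initialLaws L ν (wilsonMeasure (d := 3) (L := L) (fundamentalRep (Fin 2)) β') t β' hβ κ hreal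
  rw [hinv] at h
  exact h

/-- ★★ **`W₁(δ_Q, μ) ≤ ∫ρ_L(Q,·)dμ`**: the product coupling `δ_Q ⊗ μ`. [folklore] -/
theorem szzWasserstein_W1_dirac_le (Q : GaugeConfig 3 L (Matrix.specialUnitaryGroup (Fin 2) ℂ)) (μ : Measure (GaugeConfig 3 L (Matrix.specialUnitaryGroup (Fin 2) ℂ))) [IsProbabilityMeasure μ] :
    szzWassersteinSq (fun U U' : GaugeConfig 3 L (Matrix.specialUnitaryGroup (Fin 2) ℂ) => Real.sqrt (torusRiemannDistSq (fundamentalLatticeRep 2) U U')) (Measure.dirac Q) μ ≤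
      ENNReal.ofReal (∫ Q', Real.sqrt (torusRiemannDistSq (fundamentalLatticeRep 2) Q Q') ∂μ) := by
  haveI := secondCountableTopology_su2
  haveI := borelSpace_config L
  have hc := Literature.Geometry.Riemannian.isCoupling_prod (Measure.dirac Q) μ
  have hρc : Continuous fun Q' : GaugeConfig 3 L (Matrix.specialUnitaryGroup (Fin 2) ℂ) => Real.sqrt (torusRiemannDistSq (fundamentalLatticeRep 2) Q Q') :=
    Real.continuous_sqrt.comp (continuous_torusRiemannDistSq_two_right Q)
  have hρi : Integrable (fun Q' : GaugeConfig 3 L (Matrix.specialUnitaryGroup (Fin 2) ℂ) => Real.sqrt (torusRiemannDistSq (fundamentalLatticeRep 2) Q Q')) μ :=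
    hρc.integrable_of_hasCompactSupport (HasCompactSupport.of_compactSpace _)
  calc szzWassersteinSq (fun U U' : GaugeConfig 3 L (Matrix.specialUnitaryGroup (Fin 2) ℂ) => Real.sqrt (torusRiemannDistSq (fundamentalLatticeRep 2) U U')) (Measure.dirac Q) μ
      ≤ ∫⁻ z, ENNReal.ofReal (Real.sqrt (torusRiemannDistSq (fundamentalLatticeRep 2) z.1 z.2)) ∂((Measure.dirac Q).prod μ) := szzWassersteinSq_le _ hc
    _ ≤ ∫⁻ Q', ENNReal.ofReal (Real.sqrt (torusRiemannDistSq (fundamentalLatticeRep 2) Q Q')) ∂μ := by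
        rw [Measure.dirac_prod]
        exact lintegral_map_le _ _
    _ = ENNReal.ofReal (∫ Q', Real.sqrt (torusRiemannDistSq (fundamentalLatticeRep 2) Q Q') ∂μ) :=
        (ofReal_integral_eq_lintegral_ofReal hρi (ae_of_all _ fun _ => Real.sqrt_nonneg _)).symm

/-- ★★★ **`W₁` geometric ergodicity from a cold start**: `W₁(κ_t(Q,·), μ_(β')) ≤ ofReal(e^(−(1−12|β'|)t)·∫ρ_L(Q,·)dμ_(β'))` for every deterministic start
`Q`, every `L`, `|β'| < 1/12`. [cite: ShenZhuZhu2022, Theorem 4.2 (4.5)] -/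
theorem wilson_szzWasserstein_W1_convergence_dirac (L : ℕ) [NeZero L] (Q : GaugeConfig 3 L (Matrix.specialUnitaryGroup (Fin 2) ℂ)) (t : ℝ≥0) (β' : ℝ) (hβ : |β'| < 1 / 12)
    (κ : ℝ≥0 → Kernel (GaugeConfig 3 L (Matrix.specialUnitaryGroup (Fin 2) ℂ))
      (GaugeConfig 3 L (Matrix.specialUnitaryGroup (Fin 2) ℂ))) [∀ t, IsMarkovKernel (κ t)]
    (hreal : ∀ (t : ℝ≥0) (x : GaugeConfig 3 L (Matrix.specialUnitaryGroup (Fin 2) ℂ))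
        (Ω : Type) [MeasurableSpace Ω] (P : Measure Ω) [IsProbabilityMeasure P]
        (W : ℝ≥0 → Ω → (Edge 3 L × NoiseIdx 2 → ℝ)) (hW : IsFlatBrownian W P)
        (U : ℝ≥0 → Ω → GaugeConfig 3 L (Matrix.specialUnitaryGroup (Fin 2) ℂ)),
        (∀ ω, U 0 ω = x) →
        (latticeLangevinDynamics (fundamentalLatticeRep 2) β').IsSolution (fundamentalRep (Fin 2))
          hW.natFiltration P W U →
        κ t x = P.map (U t))
    :
    szzWassersteinSq (fun U U' : GaugeConfig 3 L (Matrix.specialUnitaryGroup (Fin 2) ℂ) => Real.sqrt (torusRiemannDistSq (fundamentalLatticeRep 2) U U')) (κ t Q) (wilsonMeasure (d := 3) (L := L) (fundamentalRep (Fin 2)) β') ≤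
      ENNReal.ofReal (Real.exp (-((1 - 12 * |β'|) * (t : ℝ))) *
        ∫ Q', Real.sqrt (torusRiemannDistSq (fundamentalLatticeRep 2) Q Q') ∂(wilsonMeasure (d := 3) (L := L) (fundamentalRep (Fin 2)) β')) := by
  haveI : IsProbabilityMeasure (wilsonMeasure (d := 3) (L := L) (fundamentalRep (Fin 2)) β') :=
    isProbabilityMeasure_wilsonMeasure (d := 3) (L := L) (fundamentalRep (Fin 2)) (continuous_fundamentalRep (Fin 2)) β'
  have h := wilson_szzWasserstein_W1_convergence_of_initialLaw L (Measure.dirac Q) t β' hβ κ hreal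
  have hbind : (Measure.dirac Q).bind (κ t) = κ t Q := Measure.dirac_bind (κ t).measurable Q
  rw [hbind] at h
  refine h.trans ?_
  rw [ENNReal.ofReal_mul (Real.exp_pos _).le]
  exact mul_le_mul_right (szzWasserstein_W1_dirac_le Q (wilsonMeasure (d := 3) (L := L) (fundamentalRep (Fin 2)) β')) _

/-- ★★ **`W₁` geometric ergodicity from a cold start, diameter form**: `W₁(κ_t(Q,·), μ_(β')) ≤ ofReal(e^(−(1−12|β'|)t)·√2·π·√#E)`.
[cite: ShenZhuZhu2022, Theorem 4.2 (4.5)] -/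
theorem wilson_szzWasserstein_W1_convergence_dirac_diam (L : ℕ) [NeZero L] (Q : GaugeConfig 3 L (Matrix.specialUnitaryGroup (Fin 2) ℂ)) (t : ℝ≥0) (β' : ℝ) (hβ : |β'| < 1 / 12)
    (κ : ℝ≥0 → Kernel (GaugeConfig 3 L (Matrix.specialUnitaryGroup (Fin 2) ℂ))
      (GaugeConfig 3 L (Matrix.specialUnitaryGroup (Fin 2) ℂ))) [∀ t, IsMarkovKernel (κ t)]
    (hreal : ∀ (t : ℝ≥0) (x : GaugeConfig 3 L (Matrix.specialUnitaryGroup (Fin 2) ℂ))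
        (Ω : Type) [MeasurableSpace Ω] (P : Measure Ω) [IsProbabilityMeasure P]
        (W : ℝ≥0 → Ω → (Edge 3 L × NoiseIdx 2 → ℝ)) (hW : IsFlatBrownian W P)
        (U : ℝ≥0 → Ω → GaugeConfig 3 L (Matrix.specialUnitaryGroup (Fin 2) ℂ)),
        (∀ ω, U 0 ω = x) →
        (latticeLangevinDynamics (fundamentalLatticeRep 2) β').IsSolution (fundamentalRep (Fin 2))
          hW.natFiltration P W U →
        κ t x = P.map (U t))
    :
    szzWassersteinSq (fun U U' : GaugeConfig 3 L (Matrix.specialUnitaryGroup (Fin 2) ℂ) => Real.sqrt (torusRiemannDistSq (fundamentalLatticeRep 2) U U')) (κ t Q) (wilsonMeasure (d := 3) (L := L) (fundamentalRep (Fin 2)) β') ≤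
      ENNReal.ofReal (Real.exp (-((1 - 12 * |β'|) * (t : ℝ))) * (Real.sqrt 2 * Real.pi * Real.sqrt (Fintype.card (Edge 3 L)))) := by
  haveI : IsProbabilityMeasure (wilsonMeasure (d := 3) (L := L) (fundamentalRep (Fin 2)) β') :=
    isProbabilityMeasure_wilsonMeasure (d := 3) (L := L) (fundamentalRep (Fin 2)) (continuous_fundamentalRep (Fin 2)) β'
  haveI := secondCountableTopology_su2
  haveI := borelSpace_config L
  refine (wilson_szzWasserstein_W1_convergence_dirac L Q t β' hβ κ hreal).trans (ENNReal.ofReal_le_ofReal ?_)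
  refine mul_le_mul_of_nonneg_left ?_ (Real.exp_pos _).le
  have hdiam : ∀ Q' : GaugeConfig 3 L (Matrix.specialUnitaryGroup (Fin 2) ℂ), Real.sqrt (torusRiemannDistSq (fundamentalLatticeRep 2) Q Q') ≤ Real.sqrt 2 * Real.pi * Real.sqrt (Fintype.card (Edge 3 L)) := by
    intro Q'
    calc Real.sqrt (torusRiemannDistSq (fundamentalLatticeRep 2) Q Q') ≤ Real.sqrt (2 * Real.pi ^ 2 * Fintype.card (Edge 3 L)) :=
          Real.sqrt_le_sqrt (torusRiemannDistSq_two_le_card Q Q')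
      _ = Real.sqrt 2 * Real.pi * Real.sqrt (Fintype.card (Edge 3 L)) := by
          rw [Real.sqrt_mul (by positivity), Real.sqrt_mul (by norm_num), Real.sqrt_sq Real.pi_pos.le]
  have hρc : Continuous fun Q' : GaugeConfig 3 L (Matrix.specialUnitaryGroup (Fin 2) ℂ) => Real.sqrt (torusRiemannDistSq (fundamentalLatticeRep 2) Q Q') :=
    Real.continuous_sqrt.comp (continuous_torusRiemannDistSq_two_right Q)
  have hρi : Integrable (fun Q' : GaugeConfig 3 L (Matrix.specialUnitaryGroup (Fin 2) ℂ) => Real.sqrt (torusRiemannDistSq (fundamentalLatticeRep 2) Q Q')) (wilsonMeasure (d := 3) (L := L) (fundamentalRep (Fin 2)) β') :=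
    hρc.integrable_of_hasCompactSupport (HasCompactSupport.of_compactSpace _)
  calc ∫ Q', Real.sqrt (torusRiemannDistSq (fundamentalLatticeRep 2) Q Q') ∂(wilsonMeasure (d := 3) (L := L) (fundamentalRep (Fin 2)) β')
      ≤ ∫ _Q', Real.sqrt 2 * Real.pi * Real.sqrt (Fintype.card (Edge 3 L)) ∂(wilsonMeasure (d := 3) (L := L) (fundamentalRep (Fin 2)) β') := integral_mono hρi (integrable_const _) hdiam
    _ = Real.sqrt 2 * Real.pi * Real.sqrt (Fintype.card (Edge 3 L)) := by rw [integral_const, probReal_univ, one_smul]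

end Summit.QuantumFields.YangMills.Theorems.ColdStartUniversality

end
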